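import Summits.ResolutionOfSingularities.ResolutionOfSingularities.Theorems.ExtinctionCutToric2
import Summits.ResolutionOfSingularities.ResolutionOfSingularities.Theorems.FreezeCutDeadClasses
import HarnessLib

/-!
# ExtinctionCutPort — decomp-res node «ExtinctionCut» (lens-3 g20, critic row 156), tree file 7/8 of the node

Content VERBATIM from the decomp-res lens-3 g20 node `HOME/decomp-res-lens-3/g20/ExtinctionCut.lean` (pin c917c20b =
`parts/ExtinctionCut-g20-c917c20b.lean`, 1 323 l; HOME = run/shared/lean/pub/decomp-res; lens imports = tree
`MaxContactCutFreezeCut` +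
`StallVertexStraightClasses` only; rc 0 · 0 sorry).  Critic: CRITIC-LEDGER row 156 (2026-08-31T00:18:27Z):
DECIDED-MOD-PORT +1 — the BALANCED
BOUNDARY CLASS `FreezeCut.NoBalancedBoundaryTailsDeep` decided AS A WHOLE modulo ONE typed port
`ExtinctionCut.KollarWallPort`.  Landing orders
INBOX :552 (critic) and :467 / :489 (the lens-3 g19 rev-4 blocks §D / §K7 = `FreezeCutDead` + classes add-on, land
first), `--kind proof --supports
stmt-ResolutionOfSingularities-31770` (`MaxContactCut.DefectWalksDeep`).  Files of the node, in import order: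
`FreezeCutDead` (§D, namespace
`…HoleCut.TailShade`, over the in-cone `MaxContactCutFreezeCut`) · `FreezeCutDeadClasses` (§K7 classes, cone-free,
namespace `…FreezeCut`) ·
`MaxContactCutFreezeCutDead` (§K7 kernels and EXACT iff's at 31770, Theses cone) · `ExtinctionCutToric` /
`ExtinctionCutToric2` (§1, Mathlib only,
namespace `…ExtinctionCut`) · `ExtinctionCutPort` (§2, the ONE typed port `KollarWallPort`, cone-free so that the
route file can cite it as an item) ·
`MaxContactCutExtinctionCut` (§3 booking at 31770, Theses cone; §M `closes` = tree
`MaxContactCutExponentLadder.closes` verbatim is omitted, as in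
`MaxContactCutFreezeCut`).  Aside bookkeeping (row 156 / INBOX :552): on the lens-3 column ONE typed PORT item
`KollarWallPort` and ONE live aside
`FreezeCut.NoSmallDeadStrictHighSkewJointTailsDeep` (home `FreezeCutDeadClasses`) superseding the rev-4 sub-class
pair; decided cells are THEOREMS and
are not filed.

## This file

§2 THE ONE EQUIV (TYPED PORT, (M+)): **`KollarWallPort`** — Kollár's coefficient-curve law [Kollar2007, Thm 1.93,
Def 2.56, Rem 2.57, Claim 2.59.1, (2.59.2), Claim 2.59.4 (v)] read on a balanced boundary tail of a forced walk:
beyond some stage a letter word `w` and shifted coefficient supports `S i t ⊆ ℤ²` with (K4) proximity repeats switch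
the letter, (BOX) stage-`N₁` supports in `[−i, ∞)²`, (K1a/K1b) exact toric transport outside `ℕ²`, (K2) `−i ≤ a + b`
(equimultiplicity), (K3) some support point outside `ℕ²` at every stage (isolation of the top locus); the §2 module
docstring carries the line-by-line DICTIONARY and the typing obligations.  A `def … : Prop` used as a hypothesis —
the ONE typed PORT item of the lens-3 column (the MAP discharge target).  Cone-free: imports `ExtinctionCutToric2`
(`step`, `InQuad`) + `FreezeCutDeadClasses` (walk vocabulary; so that ONE route import covers the port and the live aside).

[WRITER NOTE (decomp-res writer g9): file split only (tree files ≤ 400 lines); namespaces, sections, section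
variables and every declaration
exactly as in the lens (the lens's global opens are replayed per file; cone-free files carry the opens of
`FreezeCutClasses.lean`, the toric kernel none).]

(Sources: Kollar2007 (Lectures on Resolution of Singularities: Thm 1.93, Def 2.56, Rem 2.57, Claim 2.59.1, (2.59.2),
Claim 2.59.4) [corpus:book:kollar2007-lectures-resolution-singularities pp. 54, 92–94]; Hauser2010Kangaroo
(arXiv:0811.4151); Moh1987; CossartPiltant2008 §2; CossartPiltant2019 Prop. 2.50; HauserPerlega2019 §1.)
-/

noncomputable section

open MvPolynomial Finset
open Literature.AlgebraicGeometry.Resolution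
open Literature.AlgebraicGeometry.Resolution.Hauser2010
open Literature.AlgebraicGeometry.Resolution.PointBlowup
open Literature.AlgebraicGeometry.Resolution.WeightedBlowup
open Summit.ResolutionOfSingularities.ResolutionOfSingularities.Theorems.TightDefectClasses
open Summit.ResolutionOfSingularities.ResolutionOfSingularities.Theorems.ProximityCut
open Summit.ResolutionOfSingularities.ResolutionOfSingularities.Theorems.TightCut
open Summit.ResolutionOfSingularities.ResolutionOfSingularities.Theorems.HoleCut

namespace Summit.ResolutionOfSingularities.ResolutionOfSingularities.Theorems.ExtinctionCut

/-! ## §2 THE ONE EQUIV — Kollár's coefficient-curve law on a balanced boundary tail (TYPED PORT, (M+))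

`KollarWallPort` is the single translation this node allows itself (lens-3 «one certified translation + split
beneath»).  It transcribes ONE named surface fact — Kollár's maximal-contact bookkeeping for an `n`-fold point of a
surface in a smooth threefold when `char ∤ n` [Kollar2007, Thm 1.93 (Weierstrass preparation), Def 2.56 with normal
form (2.56.1), Rem 2.57 (exactly the two uses of `char ∤ n`: the Tschirnhaus substitution and Claim 2.59.1),
Claim 2.59.1, (2.59.2.x/y), Claim 2.59.4 (i)–(iii),(v)] [corpus:book:kollar2007-lectures-resolution-singularities
pp. 54, 92–94] — into the vocabulary of `ForcedWalk`, for the tails of the class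
`FreezeCut.NoBalancedBoundaryTailsDeep` (boundary line `p^e + 1 = 2s`, late multiplicity vector a permutation of
`(0, s-1, s-1)`, plateau, proximity repeats beyond every bound).  Nothing in it refers to the conclusion `False` of the
class: it hands the kernel a WORD `w : ℕ → Bool` and SUPPORT SETS `S i t ⊆ ℤ²`, and §1/§3 do the deciding.

DICTIONARY (stage `t ≥ N₁`, `q = p^e = 2n - 1`, `n = s`; `o_t = ordZero F_t = q - 1 + n` by plateau + balance).
* WALLS.  `r_t` is a permutation of `(0, n-1, n-1)`; the two indices with `r = n-1` are the walls `H¹_t, H²_t`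
  (coordinate hyperplanes `y_{H¹} = 0`, `y_{H²} = 0` of the model — exceptional components), the third index `Z_t` has
  `r = 0`.  Root invariant (`IsRoot`, `ForcedWalk.st_succ`): `F_t = y^{r_t} · G_t` with `ordZero G_t = n` exactly
  (`shade = ordZero F - |r| = n`).  ARITHMETIC: `p ∤ n` (from `p^e + 1 = 2n`: `2n ≡ 1 (mod p)`), and `p ≠ 2`.
* REGULARITY.  `G_t` is `y_Z`-regular of order `n` (the monomial `y_Z^n` occurs in `in(G_t)`), for every `t ≥ N + 1`.
  Proof: (pencil law) a plateau move `t → t+1` centred at the point `P_t` of `ℙ(T_0) = ℙ²` means `P_t` is an `n`-fold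
  point of the strict transform of `S_t := {G_t = 0}` (the factor `y^{r}` transforms into the new monomial, the unit
  and the cleaning term `h^q ∈ 𝔪^{q+n}` do not change orders `≤ q - 1 + n`), hence `in(G_t)(1, v', w')` is a polynomial
  of degree `≤ n` with an `n`-fold point, i.e. `in(G_t) = Ψ_t(ℓ, ℓ')` is a binary form in the two linear forms through
  `P_t` [elementary; it is the surface case of «near points lie on the directrix», cf. Kollar2007 p. 94 l. 1–2].
  On a balanced tail `P_t` lies on exactly one old wall, the KEPT wall `v = 0` (so `ℓ = v`), and the new double curve
  `E_t ∩ {v = 0}` has `G_{t+1}`-transversal order `n` iff `Ψ_t(0,1) ≠ 0` iff `v ∤ in(G_t)` (chart formula: the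
  coefficient of `w'^n` in `u^{-n} G_t(u, uv', uw')` is that of `w^n` in `in(G_t)|_{v=0} = Ψ_t(0, w)`; unit and cleaning
  term do not touch it).  If `v | in(G_t)` then `in(G_{t+1}) = v'·Ψ₁(v', w') + u'·R`, and a REPEAT at move `t+1` (centre
  on `E_t = {u' = 0}`, chart `v'`) would need `in(G_{t+1}) ∈ K[u', w' - γv']`, whose restriction to `u' = 0` is
  `c (w' - γ v')^n = v' Ψ₁` — impossible for `n ≥ 1` unless `Ψ_t = 0`; and a non-repeat keeps `v' | in(G_{t+1})` (restrict
  to `v' = 0`).  So `v | in(G_t)` forbids repeats after `t`, contradicting `hrec`; hence regularity from `N + 1` on.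
* NORMAL FORM [Kollar2007 1.93 + 2.56/2.57].  For `t ≥ N₁ := N + 1`, in `K[[u, v]][[y_Z]]` with `u = y_{H¹_t}`,
  `v = y_{H²_t}`: `G_t = unit · P_t`, `P_t = wⁿ + Σ_{i=2}^{n} a_i^{(t)}(u, v) w^{n-i}`, `w = y_Z + φ_t(u, v)` (Tschirnhaus,
  `p ∤ n`), `mult₀ a_i^{(t)} ≥ i`.  `S i t := {(A - i, B - i) : u^A v^B ∈ supp a_i^{(N₁+t)}} ⊆ ℤ²` (shifted supports;
  `S i t = ∅` for `i ∉ [2, n]`).  BOX: `mult a_i ≥ i` and `A, B ≥ 0` give `-i ≤ a, -i ≤ b, -i ≤ a + b` on `S i 0`.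
* CENTRES ARE TORUS-FIXED [Kollar2007 2.59.1 + balance].  By 2.59.1 (`p ∤ n`, Hasse-derivative form of Kollár's
  differentiation argument, Rem 2.57) the `n`-fold directions are `{w̄ = 0} ∩ {mult a_i ≥ i}`; by balance the centre is
  on the kept wall and off the lost one, i.e. it is `[1:0:0]` or `[0:1:0]` in `(u, v, w)` — no translation in the adapted
  coordinates (the model's translation `b_Z = -(linear part of φ_t)` is absorbed by `w`).  LETTER `w t := true` iff move
  `N₁ + t` keeps the current `v`-wall (its exceptional divisor becomes the new `u`-wall), `false` symmetrically; a move
  whose centre lies on the newest component `E` (`StaysOnNewest`, i.e. `W.b (t+1) (W.j t) = 0 ∧ W.j (t+1) ≠ W.j t`) keeps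
  `E`, which carries the letter just written, so THE LETTER SWITCHES (clause K4).
* TORIC LAW MOD ℕ² [Kollar2007 (2.59.2.x), 2.59.4 (v): `B_{i,j+1} = π⁻¹_* B_{i,j} + (mult B_{i,j} - i)·E`].  In the chart
  `u' = u, v' = v/u, w' = w/u` the strict transform is `P' = w'ⁿ + Σ u^{-i} a_i(u', u'v') w'^{n-i}` — on shifted exponents
  the letter `true` acts by `U : (a, b) ↦ (a + b, b)`, `false` by `V : (a, b) ↦ (a, a + b)` (§1 `step`).  The model
  state differs from `P'` by (1) a unit, (2) the cleaning term: `F_{t+1} = u'^{o-q} v'^{n-1} · (Ũ P' ) - h^q` and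
  `y^{r_{t+1}} = u'^{n-1} v'^{n-1}` divides `h^q`, so (Frobenius, `q = p^e`) `(u'v')^n | h^q / y^{r_{t+1}} =: C̃`, and (3)
  Weierstrass re-preparation + Tschirnhaus of `Ũ P' - C̃` w.r.t. `w'`: modulo the ideal `I = (u'v')ⁿ ⊂ K[[u',v']]` the
  prepared data are unchanged (uniqueness of 1.93 over `K[[u',v']]/I`), so `a_i^{(t+1)} ≡ u^{-i} a_i(u', u'v') mod I`, and
  `I · w'^{n-i}` only meets exponents `(A, B) ≥ (n, n)`, i.e. shifted `(a, b) ≥ (n - i, n - i) ≥ (0, 0)`.  Hence EXACTLY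
  `S i (t+1) ∖ ℕ² = U(S i t) ∖ ℕ²` (resp. `V`) — clauses K1a/K1b.  (In the adapted coordinates of stage `t + 1` the walls
  are again `u', v'`: the new exceptional divisor and the kept wall.)
* EQUIMULTIPLICITY [Kollar2007 2.59.1].  The next move is a plateau, so its centre is `n`-fold for `S_{t+1}`:
  `mult₀ a_i^{(t+1)} ≥ i`, i.e. `-i ≤ a + b` on all of `S i (t+1)` — clause K2 (at `t = 0` from `ordZero G = n`).
* ISOLATION [`ForcedWalk.isolated`, `IsolatedTop`/`topIdeal` of `TightDefectClasses`].  If at some stage every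
  `S i t ⊆ ℕ²` then `(uv)^i | a_i` for all `i`, so `P ∈ (v, w)ⁿ = 𝔓ⁿ`, `𝔓` the ideal of the wall curve `Γ = {v = w = 0}`,
  and `F = u^{n-1} v^{n-1} · unit · P ∈ 𝔓^{(n-1)+n} = 𝔓^{q}`; Hasse derivatives of order `< q` (in any coordinate system)
  map `𝔓^q` into `𝔓`, so `topIdeal q F ⊆ 𝔓` and no `g` with `g(0) ≠ 0` has `g · y_i^N ∈ topIdeal q F` for the coordinate
  `y_i = u` (restrict to `Γ`): `¬ IsolatedTop q F`, contradicting `W.isolated`.  Hence clause K3: at every stage some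
  `S i t` has a point outside `ℕ²`.
PORT OBLIGATIONS for a prover typing it: Weierstrass preparation 1.93 in `MvPowerSeries` over `K[[u,v]]` and over
`K[[u,v]]/(uv)ⁿ`; the Hasse-derivative form of 2.59.1 for `p ∤ n`; the pencil law; the chain rule
`hasseDeriv (𝔓^q) ⊆ 𝔓` for a coordinate prime `𝔓`; the bookkeeping `F_t = y^{r_t} G_t` along `ForcedWalk.st_succ`.
[cite: Kollar2007, Thm 1.93, Def 2.56, Rem 2.57, Claim 2.59.1, (2.59.2), Claim 2.59.4; ZariskiSamuel1960, vol. II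
ch. VII §1 Thm 5 (Weierstrass preparation); CossartJannsenSaito2009 = arXiv:0905.2191, §2 (directrix / near points)]
[KNOWN-MOD-PORT (M+) · the ONE EQUIV of this node · new as a typed statement] -/

/-- **THE PORT (ONE EQUIV).**  Kollár's coefficient-curve law [Kollar2007, 1.93, 2.56–2.57, 2.59.1, (2.59.2),
2.59.4 (v)] read on a balanced boundary tail of a forced walk: beyond some stage `N₁ ≥ N` there are a letter word
`w` and shifted coefficient supports `S i t ⊆ ℤ²` (`i ≤ s`) such that (K4) a proximity repeat switches the letter,
(BOX) stage-`N₁` supports lie in `[-i, ∞)²`, (K1a/K1b) outside the quadrant `ℕ²` the supports move EXACTLY by the toric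
substitution `step (w t)` of §1, (K2) every support point has `-i ≤ a + b` (equimultiplicity of every move), (K3) at
every stage some support point lies outside `ℕ²` (isolation of the top locus).  See the §2 module docstring for the
line-by-line dictionary and the typing obligations. [KNOWN-MOD-PORT (M+)] (Sources: Kollar2007, Thm 1.93, Def 2.56,
Rem 2.57, Claim 2.59.1, (2.59.2.x), Claim 2.59.4 (v).) -/
def KollarWallPort : Prop :=
  ∀ p : ℕ, p.Prime → ∀ e : ℕ, ∀ (K : Type) [Field K] [CharP K p] [PerfectField K] [DecidableEq K]
    (s₀ : State (Fin 3) K), IsRoot (p ^ e) s₀ → ∀ W : ForcedWalk (p ^ e) s₀,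
    ∀ N : ℕ, (∀ t, N ≤ t → (W.st (t + 1)).shade = (W.st t).shade) →
    (∀ M : ℕ, ∃ t, M ≤ t ∧ StaysOnNewest W t) →
    ∀ s : ℕ, (W.st N).shade = (s : ℕ∞) → 2 ≤ s → p ^ e + 1 = 2 * s →
    (∀ t, N ≤ t → ((W.st t).r.degree + 1 = p ^ e ∧ ∃ x, (W.st t).r x = 0 ∧ ∀ y, y ≠ x → (W.st t).r y + 1 = s)) →
    ∃ N₁ : ℕ, N ≤ N₁ ∧ ∃ (w : ℕ → Bool) (S : ℕ → ℕ → Set (ℤ × ℤ)),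
      (∀ t, StaysOnNewest W (N₁ + t) → w (t + 1) ≠ w t) ∧
      (∀ i, i ≤ s → ∀ x ∈ S i 0, -(i : ℤ) ≤ x.1 ∧ -(i : ℤ) ≤ x.2) ∧
      (∀ i, i ≤ s → ∀ t, ∀ x ∈ S i t, ¬ InQuad (step (w t) x) → step (w t) x ∈ S i (t + 1)) ∧
      (∀ i, i ≤ s → ∀ t, ∀ y ∈ S i (t + 1), ¬ InQuad y → ∃ x ∈ S i t, step (w t) x = y) ∧
      (∀ i, i ≤ s → ∀ t, ∀ x ∈ S i t, -(i : ℤ) ≤ x.1 + x.2) ∧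
      (∀ t, ∃ i, i ≤ s ∧ ∃ x ∈ S i t, ¬ InQuad x)

end Summit.ResolutionOfSingularities.ResolutionOfSingularities.Theorems.ExtinctionCut
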